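import Literature.AlgebraicGeometry.Frobenioids.EquivalencePreStepsQuasiIsotropic
import HarnessLib

/-!
# Frobenioids I, §3: towards Theorem 3.4 (v) — an equivalence respects base-isomorphism classes of
# objects (quasi-isotropic type, bases of FSM-type)

Mochizuki, *The geometry of Frobenioids I: the general theory*, Kyushu J. Math. **62** (2008),
Thm. 3.4 (v), kurims p. 62: "`Ψ` induces a 1-unique equivalence `Ψ^Base : D₁ ⥲ D₂` with
`Base₂ ∘ Ψ ≅ Ψ^Base ∘ Base₁`" [cite: MochizukiFrdI2008, Thm. 3.4 (v) p.62]. A first, object-level brick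
of the cell's repair programme over bases of FSM-type (seat abc-iut-L1-t13; PROOF-ONLY): two objects of
`C₁` have isomorphic base objects iff their images under `Ψ` do (Def. 1.3 (i)(b): a base-isomorphism
class is witnessed by a span of pre-steps, and pre-steps — hence base-isomorphisms — are preserved by
`Ψ` and `Ψ⁻¹`, `FrdI.isPreStep_map_of_quasiIsotropic_of_isOfFSMType`). So `A ↦ Base(Ψ A)` is a
well-defined bijection between isomorphism classes of base objects in the essential images of `Base₁`,
`Base₂` (all of `D_i` by Def. 1.3 (i)(a)). No statement of the paper is restated or strengthened.
-/

set_option backward.isDefEq.respectTransparency false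

namespace Literature.AlgebraicGeometry.Frobenioids

open CategoryTheory Opposite

universe w v v' u u'

namespace FrdI

section Two

variable {D₁ : Type u} [Category.{v} D₁] {Φ₁ : D₁ᵒᵖ ⥤ CommMonCat.{w}} {C₁ : Type u'}
  [Category.{v'} C₁] {D₂ : Type u} [Category.{v} D₂] {Φ₂ : D₂ᵒᵖ ⥤ CommMonCat.{w}} {C₂ : Type u'}
  [Category.{v'} C₂] {F₁ : C₁ ⥤ ElemFrobenioid Φ₁} {F₂ : C₂ ⥤ ElemFrobenioid Φ₂}

/-- If `Base(A) ≅ Base(B)` then `Base(Ψ A) ≅ Base(Ψ B)` (Def. 1.3 (i)(b) + pre-steps preserved).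
[cite: MochizukiFrdI2008, Thm. 3.4 (v) p.62] -/
theorem nonempty_baseIso_map (hF₁ : PreFrobenioid.IsFrobenioid F₁) (hF₂ : PreFrobenioid.IsFrobenioid F₂)
    (hq₁ : (PreFrobenioidData.ofFunctor Φ₁ F₁).IsOfQuasiIsotropicType)
    (hq₂ : (PreFrobenioidData.ofFunctor Φ₂ F₂).IsOfQuasiIsotropicType) (hD₂ : IsOfFSMType D₂)
    (Ψ : C₁ ≌ C₂) {A B : C₁}
    (h : Nonempty (PreFrobenioid.baseObj F₁ A ≅ PreFrobenioid.baseObj F₁ B)) :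
    Nonempty (PreFrobenioid.baseObj F₂ (Ψ.functor.obj A) ≅ PreFrobenioid.baseObj F₂ (Ψ.functor.obj B)) := by
  obtain ⟨e⟩ := h
  obtain ⟨X, φ, ψ, hφ, hψ, -⟩ := hF₁.i_b A B e
  have hΨφ := isPreStep_map_of_quasiIsotropic_of_isOfFSMType hF₁ hF₂ hq₁ hq₂ hD₂ Ψ hφ
  have hΨψ := isPreStep_map_of_quasiIsotropic_of_isOfFSMType hF₁ hF₂ hq₁ hq₂ hD₂ Ψ hψ
  haveI : IsIso (PreFrobenioid.Base F₂ (Ψ.functor.map φ)) := hΨφ.2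
  haveI : IsIso (PreFrobenioid.Base F₂ (Ψ.functor.map ψ)) := hΨψ.2
  exact ⟨(asIso (PreFrobenioid.Base F₂ (Ψ.functor.map φ))).symm ≪≫ asIso (PreFrobenioid.Base F₂ (Ψ.functor.map ψ))⟩

/-- **`Ψ` respects base-isomorphism classes of objects in both directions**: `Base(A) ≅ Base(B)` iff
`Base(Ψ A) ≅ Base(Ψ B)` (quasi-isotropic type, bases of FSM-type). [cite: MochizukiFrdI2008, Thm. 3.4 (v) p.62] -/
theorem nonempty_baseIso_iff (hF₁ : PreFrobenioid.IsFrobenioid F₁) (hF₂ : PreFrobenioid.IsFrobenioid F₂)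
    (hq₁ : (PreFrobenioidData.ofFunctor Φ₁ F₁).IsOfQuasiIsotropicType)
    (hq₂ : (PreFrobenioidData.ofFunctor Φ₂ F₂).IsOfQuasiIsotropicType) (hD₁ : IsOfFSMType D₁)
    (hD₂ : IsOfFSMType D₂) (Ψ : C₁ ≌ C₂) (A B : C₁) :
    Nonempty (PreFrobenioid.baseObj F₁ A ≅ PreFrobenioid.baseObj F₁ B) ↔
      Nonempty (PreFrobenioid.baseObj F₂ (Ψ.functor.obj A) ≅ PreFrobenioid.baseObj F₂ (Ψ.functor.obj B)) := by
  refine ⟨nonempty_baseIso_map hF₁ hF₂ hq₁ hq₂ hD₂ Ψ, fun h => ?_⟩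
  obtain ⟨e⟩ := nonempty_baseIso_map hF₂ hF₁ hq₂ hq₁ hD₁ Ψ.symm h
  -- transport back along the unit isomorphisms `A ≅ Ψ⁻¹ Ψ A`
  let iA : PreFrobenioid.baseObj F₁ A ≅ PreFrobenioid.baseObj F₁ (Ψ.inverse.obj (Ψ.functor.obj A)) :=
    (PreFrobenioid.baseFunctor F₁).mapIso (Ψ.unitIso.app A)
  let iB : PreFrobenioid.baseObj F₁ B ≅ PreFrobenioid.baseObj F₁ (Ψ.inverse.obj (Ψ.functor.obj B)) :=
    (PreFrobenioid.baseFunctor F₁).mapIso (Ψ.unitIso.app B)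
  exact ⟨iA ≪≫ e ≪≫ iB.symm⟩

/-- Every object of `D₂` is, up to isomorphism, the base of the image of an object of `C₁` (Def. 1.3
(i)(a) in `C₂`, essential surjectivity of `Ψ`). [cite: MochizukiFrdI2008, Thm. 3.4 (v) p.62] -/
theorem exists_baseIso_map_obj (hF₂ : PreFrobenioid.IsFrobenioid F₂) (Ψ : C₁ ≌ C₂) (Y : D₂) :
    ∃ A : C₁, Nonempty (PreFrobenioid.baseObj F₂ (Ψ.functor.obj A) ≅ Y) := by
  obtain ⟨B, -, ⟨e⟩⟩ := hF₂.i_a Y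
  exact ⟨Ψ.inverse.obj B, ⟨(PreFrobenioid.baseFunctor F₂).mapIso (Ψ.counitIso.app B) ≪≫ e⟩⟩

end Two

end FrdI

end Literature.AlgebraicGeometry.Frobenioids
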